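import Literature.NumberTheory.Automorphic.WhittakerMultiplicityOneReduction
import Literature.NumberTheory.Automorphic.GLnBiWhittakerDistributions
import HarnessLib

/-!
# Uniqueness of Whittaker functionals for `GL_n(F)` (local multiplicity one): the discharge

This sibling file of `Literature.NumberTheory.Automorphic.WhittakerModels` discharges the named fact
`Literature.NumberTheory.Automorphic.rank_whittakerFunctionals_le_one π ψ` (Gelfand–Kazhdan 1975,
Thm. C as vendored; Shalika 1974, Thm. 3.1; Bernstein–Zelevinsky 1977, §4.7): for every irreducible
smooth complex representation `π` of `GL_n(F)`, `F` a non-archimedean local field, on a space in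
any universe, and every non-trivial continuous additive character `ψ`,
`dim Hom_{U_n}(π, ψ_U) ≤ 1`.

It is the meeting point of the two lines of the tree:

* `rank_whittakerFunctionals_le_one_of_gelfandKazhdanA` (`WhittakerMultiplicityOneReduction`, the
  Bernstein–Zelevinsky route: cuspidal support, exactness of the twisted Jacquet functor, heredity
  of Whittaker functionals, the tensor decomposition of the cuspidal datum, and the two-functional
  Gelfand–Kazhdan criterion for supercuspidal representations,
  `WhittakerModelsGelfandKazhdanPairs`): the named fact for spaces in the universe of `F` follows
  from Gelfand–Kazhdan's Theorem A for `GL_m(F)`, `2 ≤ m ≤ n`, and the characters `ψ`, `ψ⁻¹`;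
* `biWhittaker_gkInvolution_stable` (`GLnBiWhittakerDistributions`): **Gelfand–Kazhdan's Theorem A
  for all `m`** — bi-`χ_U`-quasi-invariant distributions on `GL_m(F)` are stable under
  `ι(g) = w⁰ ᵗg w⁰`, for every non-trivial continuous `χ`.

The passage to an arbitrary universe of the representation space is the transport of
`Representation.isAdmissible_of_jacquetAdmissibilityStatement_fin` (`π` is cyclic, hence its space
is small; `π` is equivalent to a representation on `Shrink V`, into which it embeds, and the rank
of Whittaker functionals does not increase along injective intertwining maps into smooth
representations, `rank_whittakerFunctionals_le_one_of_injective`). Theorems only; no `sorry`.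

## References

* I. M. Gelfand, D. A. Kazhdan, *Representations of the group GL(n, K) where K is a local field*,
  in: Lie groups and their representations (Budapest 1971), Halsted (1975), 95–118.
  [GelfandKazhdan1975]
* J. A. Shalika, *The multiplicity one theorem for GL_n*, Ann. of Math. 100 (1974), Thm. 3.1.
  [Shalika1974]
* I. N. Bernstein, A. V. Zelevinsky, *Induced representations of reductive `p`-adic groups I*,
  Ann. Sci. ÉNS 10 (1977), §4.7. [BernsteinZelevinskyASENS1977]
* D. Bump, *Automorphic Forms and Representations* (1997), Theorems 4.4.1–4.4.2. [Bump1997]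
-/

namespace Literature.NumberTheory.Automorphic

universe u v

variable {F : Type u} [Field F] [ValuativeRel F] [TopologicalSpace F] [IsNonarchimedeanLocalField F]
  {n : ℕ} {V : Type v} [AddCommGroup V] [Module ℂ V]
  (π : Representation ℂ (GL (Fin n) F) V) (ψ : AddChar F Circle)

/-- **Uniqueness of Whittaker functionals (local multiplicity one) for `GL_n(F)`** — discharge of
the named fact `rank_whittakerFunctionals_le_one`: for `π` irreducible smooth (space in any
universe) and `ψ` non-trivial continuous, `Module.rank ℂ (whittakerFunctionals π ψ) ≤ 1`.
Gelfand–Kazhdan's Theorem A (`biWhittaker_gkInvolution_stable`, all `m`, characters `ψ`, `ψ⁻¹`)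
fed into the Bernstein–Zelevinsky reduction `rank_whittakerFunctionals_le_one_of_gelfandKazhdanA`,
after transporting `π` to a representation on `Shrink V` in the universe of `F`.
(Gelfand–Kazhdan 1975, Thm. C; Shalika 1974, Thm. 3.1; Bernstein–Zelevinsky 1977, §4.7.)
[cite: GelfandKazhdan1975, Thm. C] [cite: BernsteinZelevinskyASENS1977, §4.7] -/
theorem rank_whittakerFunctionals_le_one_holds : rank_whittakerFunctionals_le_one π ψ := by
  intro _ hπ hψ
  -- `V` is small: `π.asModule` is a simple, hence cyclic, `ℂ[G]`-module
  haveI : Nontrivial π.asModule :=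
    IsSimpleModule.nontrivial (MonoidAlgebra ℂ (GL (Fin n) F)) π.asModule
  obtain ⟨x, hx⟩ := exists_ne (0 : π.asModule)
  haveI : Small.{u} π.asModule :=
    small_of_surjective
      (IsSimpleModule.toSpanSingleton_surjective (MonoidAlgebra ℂ (GL (Fin n) F)) hx)
  haveI : Small.{u} V := small_map π.asModuleEquiv.symm.toEquiv
  -- transport `π` to `Shrink.{u} V`
  let f : V ≃ₗ[ℂ] Shrink.{u} V := (Shrink.linearEquiv ℂ V).symm
  let π' : Representation ℂ (GL (Fin n) F) (Shrink.{u} V) := f.conjRingEquiv.toMonoidHom.comp π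
  have hπ' : ∀ g y, π' g y = f (π g (f.symm y)) := fun g y => rfl
  let e : π.Equiv π' :=
    Representation.Equiv.mk f fun g => LinearMap.ext fun y => by
      change f (π g y) = π' g (f y)
      rw [hπ', LinearEquiv.symm_apply_apply]
  have h1 : π'.IsSmooth := fun w => by
    change IsOpen (π'.stabilizerSubgroup w : Set (GL (Fin n) F))
    rw [← e.apply_symm_apply w, e.stabilizerSubgroup_apply]
    exact hπ _
  haveI : π'.IsIrreducible :=
    Literature.RepresentationTheory.Semisimple.Representation.isIrreducible_of_equiv e
  -- multiplicity one for `π'` (universe of `F`): Bernstein–Zelevinsky reduction + Theorem A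
  have h2 : Module.rank ℂ ↥(whittakerFunctionals π' ψ) ≤ 1 := by
    refine rank_whittakerFunctionals_le_one_of_gelfandKazhdanA π' ψ (fun m _ _ χ hχ => ?_) h1 hψ
    have hχ' : χ.IsContinuousNontrivial := by
      rcases hχ with rfl | rfl
      · exact hψ
      · exact hψ.inv
    exact biWhittaker_gkInvolution_stable χ hχ'
  -- back to `π` along the injective intertwining map `e : π → π'`
  exact rank_whittakerFunctionals_le_one_of_injective ψ h1 hψ.1 e.toIntertwiningMap
    (fun a b h => f.injective h) h2

end Literature.NumberTheory.Automorphic
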